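import Summits.BirchSwinnertonDyer.BirchSwinnertonDyer.Theorems.GenusKolyvaginAtTwoPowDvdShaCardAtTwoRTExactSwapHybridFrob
import Summits.BirchSwinnertonDyer.BirchSwinnertonDyer.Theorems.CMKolyvaginAtInertTwoLowerSwapCoreAtTwo
import HarnessLib

/-!
# Route `CMKolyvaginAtInertTwo`, crux `CMKolyvaginExactAtInertTwo` (stmt-BirchSwinnertonDyer-24277), `stub_lower` —
# PORT OF gk2's LINE 18, FILE C2b: THE EXACT PRIME SWAP ON THE HYBRID FRAME, INSTANTIATED, and the `hswap` SOCKET — ON THE CM-INERT HABITAT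

Seat `bsd-line-cmk2-p1` g19 (cell `bsd-print-cf2`), `--supports stmt-BirchSwinnertonDyer-24277` (helper; closes nothing).
THEOREMS ONLY (no definition, no named fact, no `sorry`).  BSD is NOT proved by any of this; the crux is not closed here.

WHAT.  LEAD gk2-p1 g18's `…RTExactSwapHybridFrob` (`exactSwap_core_hybrid_frob` → `exactSwapAtTwo` → `deepSwap_socket` = the DROPS socket
`hswap` of the KS assembly) over file C2a's H₂ core swap.  The local pieces P8/P4/τ-stability/P5/P7a⁼/P7b⁼ are image-free tree theorems
(KRR, JET, krr2-p2, gk2-p3 g23) and are discharged exactly as in LEAD's file; T2 (`c_M(n)` Kummer off `n`, odd Tamagawa) is re-proved here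
from the image-free `P2.TamagawaSelmerAtTwo.kolyvaginClass_mem_selmerLocalKer_two_pow_of_not_mem` instead of the `ρ_{2^∞}`-onto lemma
(`pow_zero_zsmul_kolyvaginClass_two_mem_selmerLocalKer_of_odd_tamagawaProduct` below).  Binders: `W.HasCM`, `CMInert W 2`, `ρ̄_{E,2}` onto,
odd Tamagawa, `K` imaginary quadratic with odd `d_K ≠ −3`, Heegner, Gross 1991 Prop. 3.7 (2) at `(W, K)`; NO (NPh).  Proofs VERBATIM
otherwise (credit LEAD gk2-p1 g18; KRR `primeSwapAtTwoLossy_of_namedFacts` for the frame construction).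

References: [McCallumLMS1991] §5 Prop. 5.2 (proof), Lemma 5.3, Lemma 4.3; [Kolyvagin1991MathAnn] §2 Thm. 2.2; [Howard2004HeegnerKolyvagin]
Lemma 2.7.3; [GrossLMS1991] Prop. 3.7 (2), Prop. 6.2 (1).
-/

set_option autoImplicit false
set_option linter.dupNamespace false

noncomputable section

open scoped Classical Pointwise
open Function NumberField IsDedekindDomain WeierstrassCurve Field
open Literature.NumberTheory.EllipticCurves Literature.NumberTheory.GaloisRepresentations
open Literature.NumberTheory.EllipticCurves.Jetchev2008 Literature.NumberTheory.EllipticCurves.ModularForms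
open Literature.NumberTheory.GaloisCohomology
open Literature.NumberTheory.EllipticCurves.GrossLMS1991 (prop37_2_reductionCongruence_inert)
open Literature.NumberTheory.GaloisRepresentations.DiscreteGaloisModule (localTatePairingZMod
  tateDual transverseSubgroup SelmerStructure)
open Literature.NumberTheory.Automorphic
open Summit.BirchSwinnertonDyer.Rank1Residual
open Summit.BirchSwinnertonDyer.Rank1Residual.JET.SelmerVocabulary
open Summit.BirchSwinnertonDyer.Rank1Residual.JET.GlobalDuality
open Summit.BirchSwinnertonDyer.BirchSwinnertonDyer.Theorems.KolyvaginLowerBoundAtTwo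
open Summit.BirchSwinnertonDyer.BirchSwinnertonDyer.Theorems.GenusExact
open Summit.BirchSwinnertonDyer.BirchSwinnertonDyer.Theorems.GenusExact.PlusDescent

namespace Summit.BirchSwinnertonDyer.BirchSwinnertonDyer.Theorems.KolyvaginLowerTwo

/-- **T2 with `t = 0` on the odd-Tamagawa habitat, in the shape the swap cores consume** (`KolSupp` / `levelIndex` currency), WITHOUT the
`ρ_{E,2^∞}`-onto binder: `c_M(n)` is Kummer at every finite place not dividing `n` — Gross 6.2 (1) / McCallum Lemma 4.3 at `2` with odd local
Tamagawa numbers, from the image-free `P2.TamagawaSelmerAtTwo.kolyvaginClass_mem_selmerLocalKer_two_pow_of_not_mem` (by the tree's definition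
of `kolyvaginClass` no admissibility input is needed). [cite: GrossLMS1991, Prop. 6.2 (1)] [cite: McCallumLMS1991, §4 Lemma 4.3] -/
theorem pow_zero_zsmul_kolyvaginClass_two_mem_selmerLocalKer_of_odd_tamagawaProduct {K : Type} [Field K] [NumberField K]
    (W : WeierstrassCurve ℚ) [W.IsElliptic] [W.IsGloballyMinimal] [NeZero (W.conductorNorm ℤ)]
    (hTam : Odd W.tamagawaProduct) (hK : IsImaginaryQuadratic K)
    (hHN : SatisfiesHeegnerHypothesis (W.conductorNorm ℤ) K)
    (Dt : ModularParametrizationData W (W.conductorNorm ℤ)) (β : ℤ) (ι : K →+* ℂ) :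
    ∀ (n : ℕ) (d : KolyvaginHeegnerData Dt β ι n) (M : ℕ),
      KolyvaginDescent.KolSupp (Zhang2014.IsKolyvaginPrime (W.conductorNorm ℤ) W K 2) n →
      1 ≤ M → (M : ℕ∞) ≤ Zhang2014.levelIndex W 2 n →
      ∀ v : HeightOneSpectrum (𝓞 K), ((n : ℕ) : 𝓞 K) ∉ v.asIdeal →
        ((2 ^ 0 : ℕ) : ℤ) • d.kolyvaginClass Nat.prime_two M ∈
          selmerLocalKer (W.baseChange K) (v.adicCompletion K) ((2 ^ M : ℕ) : ℤ) := by
  intro n d M hn _ _ v hv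
  rw [pow_zero, Nat.cast_one, one_zsmul]
  exact P2.TamagawaSelmerAtTwo.kolyvaginClass_mem_selmerLocalKer_two_pow_of_not_mem d hK hHN hTam hn.1.ne_zero M v hv

section Frame

variable {K : Type} [Field K] [NumberField K] (W : WeierstrassCurve ℚ) [W.IsElliptic]
  [W.IsGloballyMinimal] [(W.baseChange K).IsElliptic] [NeZero (W.conductorNorm ℤ)]
  [∀ M : ℕ, NeZero (2 ^ M)] [∀ M : ℕ, Finite (geomTorsion (W.baseChange K) ((2 ^ M : ℕ) : ℤ))]
  (τ : K ≃ₐ[ℚ] K)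
  (Dt : ModularParametrizationData W (W.conductorNorm ℤ)) (β : ℤ) (ι : K →+* ℂ)
  [∀ j : ℕ, NumberField (ringClassField K ι j)]
  (e : ∀ M : ℕ, geomTorsion (W.baseChange K) ((2 ^ M : ℕ) : ℤ) →
    geomTorsion (W.baseChange K) ((2 ^ M : ℕ) : ℤ) → AlgebraicClosure K)
  (hμ : ∀ M S T, e M S T ^ (2 ^ M) = 1)
  (hadd₁ : ∀ M S₁ S₂ T, e M (S₁ + S₂) T = e M S₁ T * e M S₂ T)
  (hadd₂ : ∀ M S T₁ T₂, e M S (T₁ + T₂) = e M S T₁ * e M S T₂)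
  (hgal : ∀ M (g : absoluteGaloisGroup K) (S T : geomTorsion (W.baseChange K) ((2 ^ M : ℕ) : ℤ)),
    g • e M S T = e M (g • S) (g • T))
  (halt : ∀ M T, e M T T = 1) (hnondeg : ∀ M T, (∀ S, e M S T = 1) → T = 0)
  (hτe : ∀ (M : ℕ) S T, liftAut τ (e M S T) =
    e M ((isLiftOfAut_liftAut τ).torsionMap W ((2 ^ M : ℕ) : ℤ) S)
      ((isLiftOfAut_liftAut τ).torsionMap W ((2 ^ M : ℕ) : ℤ) T))
  (inv : ∀ M : ℕ, LocalInvariants K (2 ^ M))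
  (𝒯 : ∀ M : ℕ, SelmerStructure ((W.baseChange K).torsionGaloisModule ((2 ^ M : ℕ) : ℤ)))
  -- the habitat of LINE 18
  (hCM : W.HasCM) (hin : Rank1Residual.CMInert W 2) (hTam : Odd W.tamagawaProduct)
  (hρ2 : W.HasSurjectiveModNGaloisRep 2) (hK : IsImaginaryQuadratic K)
  (hodd : Odd (NumberField.discr K)) (hne3 : NumberField.discr K ≠ -3)
  (hHN : SatisfiesHeegnerHypothesis (W.conductorNorm ℤ) K)
  (h37 : prop37_2_reductionCongruence_inert (W.conductorNorm ℤ) W K)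
  (hτ1 : τ ≠ 1)
  (hperf : ∀ M, (inv M).IsPerfect) (hvan : ∀ M, (inv M).SumLocalTermEqZero)
  (hinvc : ∀ M, (inv M).IsConjCompatible τ) (hSC : ∀ M, (inv M).SelmerComplement)
  -- the hybrid transverse structures
  (hTko : ∀ (M : ℕ) (v : HeightOneSpectrum (𝓞 K)) (q : ℕ),
    Zhang2014.IsKolyvaginPrime (W.conductorNorm ℤ) W K 2 q → M + 1 ≤ Zhang2014.kolyvaginIndex W 2 q →
    (q : 𝓞 K) ∈ v.asIdeal →
    𝒯 M (Sum.inr v) = ⨅ (w' : HeightOneSpectrum (𝓞 (ringClassField K ι q)))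
        (_ : w'.asIdeal.LiesOver v.asIdeal),
        letI := (adicCompletionOfLiesOver K (ringClassField K ι q) v w').toAlgebra
        transverseSubgroup (GaloisRep.toLocal v ((W.baseChange K).torsionGaloisModule ((2 ^ M : ℕ) : ℤ)))
          (w'.adicCompletion (ringClassField K ι q)))
  (hTku : ∀ (M : ℕ) (v : HeightOneSpectrum (𝓞 K)),
    (¬ ∃ q : ℕ, Zhang2014.IsKolyvaginPrime (W.conductorNorm ℤ) W K 2 q ∧
        M + 1 ≤ Zhang2014.kolyvaginIndex W 2 q ∧ (q : 𝓞 K) ∈ v.asIdeal) →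
    𝒯 M (Sum.inr v) = (W.baseChange K).kummerSelmerStructure ((2 ^ M : ℕ) : ℤ) (Sum.inr v))

include hμ hadd₁ hadd₂ hgal halt hnondeg hτe hCM hin hTam hρ2 hK hodd hne3 hHN h37 hτ1 hperf hvan hinvc hSC hTko hTku in
/-- **The exact prime swap at `2` on the HYBRID transverse frame, ON THE CM-INERT HABITAT — all local pieces discharged** (LEAD gk2-p1 g18's
`exactSwap_core_hybrid_frob` re-threaded over file C2a's core): P8 (`dualTransported_eq_of_hybrid`), P4 (= (V44) at margin one,
`JET.localization_kolyvaginClass_mem_globalTransverse_two`), τ-stability, P5 (krr2-p2's signed auxiliary class `exists_auxClass_large_at_two`),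
P7a⁼/P7b⁼ (gk2-p3 g23's exact local laws; `Δ < 0` from the habitat) and T2 with `t = 0` (odd Tamagawa; the image-free `P2.TamagawaSelmerAtTwo`
leaf) DISCHARGED — all image-free.  Displayed: Gross 3.7 (2) at `(W, K)` and the hybrid structures; NO (NPh).  Conclusion = gk2's, incl. the
level-2 Gross condition of the fresh prime.  [cite: McCallumLMS1991, §5 Prop. 5.2 (proof), Lemma 5.3, Lemma 4.3] [cite: Howard2004HeegnerKolyvagin, Lemma 2.7.3]
[cite: GrossLMS1991, Prop. 6.2] -/
theorem exactSwap_core_hybrid_frob {M k g n a : ℕ} (X : Finset ℕ) (dat : KolyvaginHeegnerData Dt β ι n)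
    (hM : 12 ≤ M) (hk : 1 ≤ k) (hn : Squarefree n)
    (hnK : ∀ p ∈ n.primeFactors, Zhang2014.IsKolyvaginPrime (W.conductorNorm ℤ) W K 2 p ∧
      M + 1 ≤ Zhang2014.kolyvaginIndex W 2 p)
    (ha : a ∈ n.primeFactors) (haF : FrobEqFrobInfty W K (2 ^ (M + k)) a)
    (hg : 1 ≤ g) (hord : addOrderOf (dat.kolyvaginClass Nat.prime_two M) = 2 ^ g)
    (hroom : M + 6 ≤ M / 2 + g) :
    ∃ ℓ : ℕ, ℓ ∉ X ∧ ℓ ∉ n.primeFactors ∧ Zhang2014.IsKolyvaginPrime (W.conductorNorm ℤ) W K 2 ℓ ∧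
      M + k ≤ Zhang2014.kolyvaginIndex W 2 ℓ ∧ FrobEqFrobInfty W K (2 ^ (M + k)) ℓ ∧ FrobEqFrobInfty W K 2 ℓ ∧
      (∀ v : HeightOneSpectrum (𝓞 K), ((ℓ : ℕ) : 𝓞 K) ∈ v.asIdeal →
        ((2 ^ (g - 1) : ℕ) : ℤ) • dat.kolyvaginClass Nat.prime_two M ∉
          (W.baseChange K).torsionLocalKer (v.adicCompletion K) ((2 ^ M : ℕ) : ℤ)) ∧
      ∃ dat' : KolyvaginHeegnerData Dt β ι (n / a * ℓ),
        ((2 ^ (g - 1) : ℕ) : ℤ) • dat'.kolyvaginClass Nat.prime_two M ≠ 0 := by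
  classical
  haveI : Fact (Nat.Prime 2) := ⟨Nat.prime_two⟩
  have hne4 : NumberField.discr K ≠ -4 := fun h ↦ by
    rw [h] at hodd; have := Int.odd_iff.mp hodd; omega
  have hD : NumberField.discr K < -4 := IsImaginaryQuadratic.discr_lt_neg_four_of_odd hK hodd hne3
  have hΔ : W.Δ < 0 := KolyvaginEigenTwo.Δ_neg_of_cmInert_two W hCM hin hρ2
  have hττ : τ * τ = 1 := mul_self_eq_one_of_isImaginaryQuadratic hK τ
  have hinj : ∀ (M : ℕ) (v : HeightOneSpectrum (𝓞 K)), Injective (inv M (Sum.inr v)) :=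
    fun M v ↦ ((hperf M) v).1.injective
  -- P8: self-duality of the hybrid structure at every finite place
  have h𝒯sd : ∀ (M c : ℕ), ∀ v ∈ placesDividing K c,
      (inv M).dualTransported (𝒯 M) (weilDualIntertwining (W.baseChange K) (2 ^ M) (e M) (hμ M) (hadd₁ M)
        (hadd₂ M) (hgal M)) (Sum.inr v) = 𝒯 M (Sum.inr v) := fun M c ↦
    dualTransported_eq_of_hybrid W M (e M) (hμ M) (hadd₁ M) (hadd₂ M) (hgal M) (halt M) (hnondeg M) (inv M)
      (𝒯 M) hK hD ι (hinj M) (fun v ↦ by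
        by_cases h : ∃ q : ℕ, Zhang2014.IsKolyvaginPrime (W.conductorNorm ℤ) W K 2 q ∧
            M + 1 ≤ Zhang2014.kolyvaginIndex W 2 q ∧ (q : 𝓞 K) ∈ v.asIdeal
        · obtain ⟨q, hq, hMq, hqv⟩ := h
          exact Or.inl ⟨q, hq, hMq, hqv, hTko M v q hq hMq hqv⟩
        · exact Or.inr (hTku M v h)) c
  -- P4: transversality at the primes of the conductor — (V44) at margin one, unconditional at 2
  have hP4 : ∀ (M c : ℕ) (dat : KolyvaginHeegnerData Dt β ι c),
      KolyvaginDescent.KolSupp (Zhang2014.IsKolyvaginPrime (W.conductorNorm ℤ) W K 2) c → 1 ≤ M →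
      (∀ q ∈ c.primeFactors, M + 1 ≤ Zhang2014.kolyvaginIndex W 2 q) →
      ∀ w ∈ placesDividing K c,
        galoisCohomology.localization ((W.baseChange K).torsionGaloisModule ((2 ^ M : ℕ) : ℤ)) (Sum.inr w) 1
          (dat.kolyvaginClass Nat.prime_two M) ∈ 𝒯 M (Sum.inr w) := by
    intro M c dat hc _ hcM w hw
    obtain ⟨𝒯g, h𝒯g, -⟩ := JET.Walk.exists_globalTransverseFamily W ι ((2 ^ M : ℕ) : ℤ)
    have hmem := JET.localization_kolyvaginClass_mem_globalTransverse_two W hK hD Dt β ι M h𝒯g dat hc hcM w hw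
    obtain ⟨q, hqc, hqw⟩ := (natCast_mem_iff_exists_primeFactor_mem hc.1.ne_zero w).mp
      ((mem_placesDividing_iff_natCast_mem hc.1.ne_zero w).mp hw)
    rw [hTko M w q (hc.2 q hqc) (hcM q hqc) hqw, ← JET.Walk.globalTransverse_eq_of_natCast_mem h𝒯g w
      (Nat.prime_of_mem_primeFactors hqc) hqw]
    exact hmem
  -- τ-stability of the hybrid structure at the places of a Kolyvagin conductor
  have h𝒯σ : ∀ (M m : ℕ), KolyvaginDescent.KolSupp (Zhang2014.IsKolyvaginPrime (W.conductorNorm ℤ) W K 2) m →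
      (∀ q ∈ m.primeFactors, M + 1 ≤ Zhang2014.kolyvaginIndex W 2 q) →
      ∀ (v w : HeightOneSpectrum (𝓞 K)) (h : τ • v = w), v ∈ placesDividing K m →
      ∀ x : galoisCohomology (((W.baseChange K).torsionGaloisModule ((2 ^ M : ℕ) : ℤ)).toLocal
        (Sum.inr v : Place K)) 1, x ∈ 𝒯 M (Sum.inr v) → conjActPlace W τ ((2 ^ M : ℕ) : ℤ) h x ∈ 𝒯 M (Sum.inr w) := by
    intro M m hm hmidx v w h hv x hx
    obtain ⟨𝒯g, h𝒯g, -⟩ := JET.Walk.exists_globalTransverseFamily W ι ((2 ^ M : ℕ) : ℤ)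
    obtain ⟨q, hqm, hqv⟩ := (natCast_mem_iff_exists_primeFactor_mem hm.1.ne_zero v).mp
      ((mem_placesDividing_iff_natCast_mem hm.1.ne_zero v).mp hv)
    have hq := hm.2 q hqm
    have hvv : τ • v = v := smul_place_eq_self_of_natCast_mem τ hq.1.ne_zero hq.2.2.2.2.1 v hqv
    have hvw : v = w := hvv.symm.trans h
    subst hvw
    have heq : 𝒯 M (Sum.inr v) = 𝒯g (Sum.inr v) := by
      rw [hTko M v q hq (hmidx q hqm) hqv, JET.Walk.globalTransverse_eq_of_natCast_mem h𝒯g v hq.1 hqv]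
    rw [heq] at hx ⊢
    exact JET.Walk.globalTransverse_conjActPlace_mem h𝒯g τ hm.1
      (JET.forall_conjActPlace_mem_of_eq_iInf_transverseSubgroup W hK ι τ _ m) v v h hv x hx
  -- P5: krr2-p2's SIGNED auxiliary class with size on the hybrid structure (M ≥ 9)
  have hP5 : ∀ (M m a : ℕ) (v₀ : HeightOneSpectrum (𝓞 K)) (s : ℤ), (s = 1 ∨ s = -1) → 9 ≤ M →
      KolyvaginDescent.KolSupp (Zhang2014.IsKolyvaginPrime (W.conductorNorm ℤ) W K 2) m →
      (∀ q ∈ m.primeFactors, M + 1 ≤ Zhang2014.kolyvaginIndex W 2 q) →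
      Zhang2014.IsKolyvaginPrime (W.conductorNorm ℤ) W K 2 a → M + 1 ≤ Zhang2014.kolyvaginIndex W 2 a →
      ¬ a ∣ m → ((a : ℕ) : 𝓞 K) ∈ v₀.asIdeal →
      ∃ w : galoisCohomology ((W.baseChange K).torsionGaloisModule ((2 ^ M : ℕ) : ℤ)) 1,
        w ∈ signPart W K τ ((2 ^ M : ℕ) : ℤ) s
          (((selmerF W ((2 ^ M : ℕ) : ℤ) (𝒯 M) (placesDividing K m)).relaxedAt {v₀}).selmerGroup) ∧
        ((2 ^ (M / 2 - 5) : ℕ) : ℤ) • w ≠ 0 := by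
    intro M m a v₀ s hs hM9 hm hmidx ha hMa ham hv₀
    have hfix : τ • v₀ = v₀ := smul_place_eq_self_of_natCast_mem τ ha.1.ne_zero ha.2.2.2.2.1 v₀ hv₀
    have hτe' : ∀ S T, liftAutPlace τ hfix (e M S T) =
        e M ((isLiftOfAut_liftAutPlace τ hfix).torsionMap W ((2 ^ M : ℕ) : ℤ) S)
          ((isLiftOfAut_liftAutPlace τ hfix).torsionMap W ((2 ^ M : ℕ) : ℤ) T) := fun S T ↦
      weil_equivariant_of_isLiftOfAut W ((2 ^ M : ℕ) : ℤ) (isLiftOfAut_liftAutPlace τ hfix) (isLiftOfAut_liftAut τ)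
        (e M) (hgal M) (hτe M) S T
    exact exists_auxClass_large_at_two W τ M (e M) (hμ M) (hadd₁ M) (hadd₂ M) (hgal M) (halt M) (hnondeg M) (inv M)
      (𝒯 M) hK hτ1 hττ (hperf M) (hvan M) (hSC M) (hinvc M) hM9 hm.1.ne_zero (h𝒯sd M m)
      (h𝒯σ M m hm hmidx) ha hMa ham v₀ hv₀ hfix hτe' hs
  -- P7a⁼ / P7b⁼: gk2-p3 g23's exact local laws (cyclic eigenlines on Δ < 0; the Frobenius binder on the swapped-out prime is necessary)
  have hP7a := swapPairing_pow_smul_ne_zero_at_two_exact (W := W) (τ := τ) (e := e) (hμ := hμ) (hadd₁ := hadd₁) (hadd₂ := hadd₂)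
    (hgal := hgal) (halt := halt) (hnondeg := hnondeg) (inv := inv) hK hΔ hτ1 hττ hτe hinj hinvc
  have hP7b := swapPairing_pow_smul_eq_zero_at_two_exact (W := W) (τ := τ) (ι := ι) (e := e) (hμ := hμ) (hadd₁ := hadd₁) (hadd₂ := hadd₂)
    (hgal := hgal) (halt := halt) (hnondeg := hnondeg) (inv := inv) (𝒯 := 𝒯) hK hD hΔ hτ1 hττ hτe hperf hinvc hTko
  -- T2 with t = 0: Gross 6.2(1) / McCallum 4.3 at 2 on the odd-Tamagawa habitat
  have hT2 := KolyvaginLowerTwo.pow_zero_zsmul_kolyvaginClass_two_mem_selmerLocalKer_of_odd_tamagawaProduct W hTam hK hHN Dt β ι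
  obtain ⟨ℓ, hℓX, hℓn, hKol, hidx, hfrob, hdet, d', hd'⟩ := KolyvaginLowerTwo.exactSwap_core_frob (W := W) (τ := τ) (Dt := Dt) (β := β)
    (ι := ι) (e := e) (hμ := hμ) (hadd₁ := hadd₁) (hadd₂ := hadd₂) (hgal := hgal) (halt := halt) (hnondeg := hnondeg) (inv := inv) (𝒯 := 𝒯)
    (hCM := hCM) (hin := hin) (hρ2 := hρ2) (hK := hK) (hodd := hodd) (hne3 := hne3) (hHN := hHN) (h37 := h37) (hτ1 := hτ1)
    (hperf := hperf) (hvan := hvan) (h𝒯sd := h𝒯sd) (hP4 := hP4) (hP5 := hP5) (hP7a := hP7a) (hP7b := hP7b)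
    (hT2 := hT2) X dat hM hk hn hnK ha haF hg hord hroom
  exact ⟨ℓ, hℓX, hℓn, hKol, hidx, hfrob, hfrob.of_dvd (dvd_pow_self 2 (by omega)), hdet, d', hd'⟩

end Frame

/-! ## The frame instantiated: the swap in pure Kolyvagin-datum currency, and gk2-p2's `hswap` socket -/

section Instantiated

variable {K : Type} [Field K] [NumberField K] (W : WeierstrassCurve ℚ) [W.IsElliptic] [W.IsGloballyMinimal] [NeZero (W.conductorNorm ℤ)]

/-- **THE EXACT PRIME SWAP AT `2` ON H₂, frame instantiated, UNCONDITIONAL up to Gross 3.7 (2) at `(W, K)`** (gk2-p2's `hswap` socket with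
margin `k`, in pure Kolyvagin-datum currency; the frame built inside as in LEAD's `exactSwapAtTwo`: Poitou–Tate families, Weil data, hybrid
transverse structures).  [cite: McCallumLMS1991, §5 Prop. 5.2 (proof), Lemma 5.3] [cite: Kolyvagin1991MathAnn, §2 Thm. 2.2] -/
theorem exactSwapAtTwo (hCM : W.HasCM) (hin : Rank1Residual.CMInert W 2) (hTam : Odd W.tamagawaProduct)
    (hρ2 : W.HasSurjectiveModNGaloisRep 2) (hK : IsImaginaryQuadratic K)
    (hodd : Odd (NumberField.discr K)) (hne3 : NumberField.discr K ≠ -3)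
    (hHN : SatisfiesHeegnerHypothesis (W.conductorNorm ℤ) K)
    (h37 : prop37_2_reductionCongruence_inert (W.conductorNorm ℤ) W K) (τ : K ≃ₐ[ℚ] K) (hτ1 : τ ≠ 1)
    (Dt : ModularParametrizationData W (W.conductorNorm ℤ)) (β : ℤ) (ι : K →+* ℂ)
    {M k g n a : ℕ} (X : Finset ℕ) (dat : KolyvaginHeegnerData Dt β ι n)
    (hM : 12 ≤ M) (hk : 1 ≤ k) (hn : Squarefree n)
    (hnK : ∀ p ∈ n.primeFactors, Zhang2014.IsKolyvaginPrime (W.conductorNorm ℤ) W K 2 p ∧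
      M + 1 ≤ Zhang2014.kolyvaginIndex W 2 p)
    (ha : a ∈ n.primeFactors) (haF : FrobEqFrobInfty W K (2 ^ (M + k)) a)
    (hg : 1 ≤ g) (hord : addOrderOf (dat.kolyvaginClass Nat.prime_two M) = 2 ^ g)
    (hroom : M + 6 ≤ M / 2 + g) :
    ∃ ℓ : ℕ, ℓ ∉ X ∧ ℓ ∉ n.primeFactors ∧ Zhang2014.IsKolyvaginPrime (W.conductorNorm ℤ) W K 2 ℓ ∧
      M + k ≤ Zhang2014.kolyvaginIndex W 2 ℓ ∧ FrobEqFrobInfty W K (2 ^ (M + k)) ℓ ∧ FrobEqFrobInfty W K 2 ℓ ∧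
      (∀ v : HeightOneSpectrum (𝓞 K), ((ℓ : ℕ) : 𝓞 K) ∈ v.asIdeal →
        ((2 ^ (g - 1) : ℕ) : ℤ) • dat.kolyvaginClass Nat.prime_two M ∉
          (W.baseChange K).torsionLocalKer (v.adicCompletion K) ((2 ^ M : ℕ) : ℤ)) ∧
      ∃ dat' : KolyvaginHeegnerData Dt β ι (n / a * ℓ),
        ((2 ^ (g - 1) : ℕ) : ℤ) • dat'.kolyvaginClass Nat.prime_two M ≠ 0 := by
  classical
  haveI : Fact (Nat.Prime 2) := ⟨Nat.prime_two⟩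
  haveI : ∀ j : ℕ, NumberField (ringClassField K ι j) := JET.numberField_ringClassField K hK ι
  haveI : (W.baseChange K).IsElliptic := by rw [baseChange]; infer_instance
  haveI hNZ : ∀ M : ℕ, NeZero (2 ^ M) := fun M ↦ ⟨pow_ne_zero M two_ne_zero⟩
  haveI : ∀ M : ℕ, Finite (geomTorsion (W.baseChange K) ((2 ^ M : ℕ) : ℤ)) := fun M ↦
    finite_geomTorsion_of_neZero (W.baseChange K) (2 ^ M)
  -- the frame, per level: Poitou–Tate families, Weil data, hybrid structures
  have hinv : ∀ M : ℕ, ∃ inv : LocalInvariants K (2 ^ M), inv.IsPerfect ∧ inv.SumLocalTermEqZero ∧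
      inv.UnramifiedOrthogonal ∧ inv.SelmerComplement ∧ ∀ σ : K ≃ₐ[ℚ] K, inv.IsConjCompatible σ :=
    fun M ↦ InputsPoitouTateSelmer.poitouTate_selmerStructure_duality_conj_holds K (2 ^ M)
  choose inv hperf hvan hUO hSC hconj using hinv
  have hweil := fun M : ℕ ↦ exists_weilDatum_liftAut_two_pow (K := K) W τ M
  choose e hμ hadd₁ hadd₂ hgal halt hnondeg hτe using hweil
  have hhyb := fun M : ℕ ↦ exists_hybridTransverseFamily (K := K) W ι M
  choose 𝒯 hTko hTku using hhyb
  exact KolyvaginLowerTwo.exactSwap_core_hybrid_frob (W := W) (τ := τ) (Dt := Dt) (β := β) (ι := ι) (e := e) (hμ := hμ) (hadd₁ := hadd₁)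
    (hadd₂ := hadd₂) (hgal := hgal) (halt := halt) (hnondeg := hnondeg) (hτe := hτe) (inv := inv) (𝒯 := 𝒯) (hCM := hCM)
    (hin := hin) (hTam := hTam) (hρ2 := hρ2) (hK := hK) (hodd := hodd) (hne3 := hne3) (hHN := hHN) (h37 := h37) (hτ1 := hτ1)
    (hperf := hperf) (hvan := hvan) (hinvc := fun M ↦ hconj M τ) (hSC := hSC) (hTko := hTko) (hTku := hTku)
    X dat hM hk hn hnK ha haF hg hord hroom

/-- **gk2-p2's `hswap` socket ON H₂, VERBATIM, modulo Gross 3.7 (2) at `(W, K)` only** (the `hswap` binder of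
`kolyvaginSuppliesAtTwo_of_deepSwap` — file B3 — for the margin-`k` class `G q := L + k ≤ index q ∧ FrobEqFrobInfty W K (2^(L+k)) q`, `k ≥ 1`,
level `L ≥ 2M₀ + 12`): LEAD gk2-p1 g18's `deepSwap_socket` re-threaded over `exactSwapAtTwo` above; no (NPh) on the CM-inert habitat.
[cite: McCallumLMS1991, §5 Prop. 5.2 (proof)] [cite: Kolyvagin1991MathAnn, §2 Thm. 2.2] -/
theorem deepSwap_socket (hCM : W.HasCM) (hin : Rank1Residual.CMInert W 2) (hTam : Odd W.tamagawaProduct)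
    (hρ2 : W.HasSurjectiveModNGaloisRep 2) (hK : IsImaginaryQuadratic K)
    (hodd : Odd (NumberField.discr K)) (hne3 : NumberField.discr K ≠ -3)
    (hHN : SatisfiesHeegnerHypothesis (W.conductorNorm ℤ) K)
    (h37 : prop37_2_reductionCongruence_inert (W.conductorNorm ℤ) W K) (τ : K ≃ₐ[ℚ] K) (hτ1 : τ ≠ 1)
    (Dt : ModularParametrizationData W (W.conductorNorm ℤ)) (β : ℤ) (ι : K →+* ℂ)
    {M₀ L k : ℕ} (hL : 2 * M₀ + 12 ≤ L) (hk : 1 ≤ k) :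
    ∀ (r m : ℕ), 1 ≤ r → m < M₀ →
      (∀ (n : ℕ) (e : KolyvaginHeegnerData Dt β ι n), Squarefree n → n.primeFactors.card = r →
        (∀ q ∈ n.primeFactors, (Zhang2014.IsKolyvaginPrime (W.conductorNorm ℤ) W K 2 q ∧ L ≤ Zhang2014.kolyvaginIndex W 2 q) ∧
          (L + k ≤ Zhang2014.kolyvaginIndex W 2 q ∧ FrobEqFrobInfty W K (2 ^ (L + k)) q)) →
        ((2 ^ (L - m) : ℕ) : ℤ) • e.kolyvaginClass Nat.prime_two L = 0) →
      ∀ (n : ℕ) (d : KolyvaginHeegnerData Dt β ι n), Squarefree n → n.primeFactors.card = r →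
      (∀ q ∈ n.primeFactors, (Zhang2014.IsKolyvaginPrime (W.conductorNorm ℤ) W K 2 q ∧ L ≤ Zhang2014.kolyvaginIndex W 2 q) ∧
        (L + k ≤ Zhang2014.kolyvaginIndex W 2 q ∧ FrobEqFrobInfty W K (2 ^ (L + k)) q)) →
      addOrderOf (d.kolyvaginClass Nat.prime_two L) = 2 ^ (L - m) →
      ∀ ℓ₀ ∈ n.primeFactors, ∀ X : Finset ℕ, ∃ ℓ' : ℕ, ℓ' ∉ X ∧ ℓ' ∉ n.primeFactors ∧
        ((Zhang2014.IsKolyvaginPrime (W.conductorNorm ℤ) W K 2 ℓ' ∧ L ≤ Zhang2014.kolyvaginIndex W 2 ℓ') ∧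
          (L + k ≤ Zhang2014.kolyvaginIndex W 2 ℓ' ∧ FrobEqFrobInfty W K (2 ^ (L + k)) ℓ')) ∧
        (∃ v : HeightOneSpectrum (𝓞 K), ((ℓ' : ℕ) : 𝓞 K) ∈ v.asIdeal ∧
          ((2 ^ (L - m - 1) : ℕ) : ℤ) • d.kolyvaginClass Nat.prime_two L ∉
            (W.baseChange K).torsionLocalKer (v.adicCompletion K) ((2 ^ L : ℕ) : ℤ)) ∧
        ∃ d' : KolyvaginHeegnerData Dt β ι (ℓ' * (n / ℓ₀)),
          ((2 ^ (L - m - 1) : ℕ) : ℤ) • d'.kolyvaginClass Nat.prime_two L ≠ 0 := by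
  intro r m _ hm _ n d hn _ hadm hord ℓ₀ hℓ₀ X
  have hnK : ∀ p ∈ n.primeFactors, Zhang2014.IsKolyvaginPrime (W.conductorNorm ℤ) W K 2 p ∧
      L + 1 ≤ Zhang2014.kolyvaginIndex W 2 p := fun p hp ↦ ⟨(hadm p hp).1.1, le_trans (by omega) (hadm p hp).2.1⟩
  obtain ⟨ℓ, hℓX, hℓn, hKol, hidx, hfrob, -, hdet, d', hd'⟩ := KolyvaginLowerTwo.exactSwapAtTwo W hCM hin hTam hρ2 hK hodd hne3 hHN h37
    τ hτ1 Dt β ι (M := L) (k := k) (g := L - m) X d (by omega) hk hn hnK hℓ₀ (hadm ℓ₀ hℓ₀).2.2 (by omega) hord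
    (by omega)
  have hℓp : ℓ.Prime := hKol.1
  obtain ⟨v, hv⟩ : ∃ v : HeightOneSpectrum (𝓞 K), ((ℓ : ℕ) : 𝓞 K) ∈ v.asIdeal :=
    ⟨⟨Ideal.span {((ℓ : ℕ) : 𝓞 K)}, hKol.2.2.2.2.1, by
        rw [Ne, Ideal.span_singleton_eq_bot]; exact_mod_cast hℓp.ne_zero⟩,
      Ideal.mem_span_singleton_self _⟩
  have hcast : n / ℓ₀ * ℓ = ℓ * (n / ℓ₀) := Nat.mul_comm _ _
  refine ⟨ℓ, hℓX, hℓn, ⟨⟨hKol, le_trans (Nat.le_add_right L k) hidx⟩, hidx, hfrob⟩,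
    ⟨v, hv, hdet v hv⟩, hcast ▸ d', ?_⟩
  rw [kolyvaginClass_cast_swap hcast d' L]
  exact hd'

end Instantiated

end Summit.BirchSwinnertonDyer.BirchSwinnertonDyer.Theorems.KolyvaginLowerTwo

end
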